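/-
Copyright: cell pub-balaban-gaps (YM BLITZ Y1, track G1), seat g1-p2 GEN 7 (unit `pub-balaban-gaps-g1-p2`).  Row (D4) NODE O,
OBJECT level: FAITHFULNESS of the whole one-scale covariant chain — the kernel of `D4WalkBlockCovariantAveraging`'s expansion IS the
inverse of the one-scale COVARIANT operator `Δ_W + m² + a_K·P_K(U)` (covariant Laplacian with transport defects (3.50), flat mass,
covariant block-averaging term), because (i) the tower's `H = −Δ^η + m²` fibres to `m²·1 + Δ_1 ⊗ 1` (`blockDiagonal_H`), (ii)
`Δ_1 ⊗ 1 − Δ_W = V_W` (59b), (iii) `V_av = a_K(P_K ⊗ 1 − P_K(U))`, (iv) `(H + a_KP_K)G′_K = 1` (the tree's `G_arg`), and (v) `1 − V·(G′⊗1)`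
IS invertible on the ball — proved here from the block letters, the cube row sum and the margin via the `ℓ^∞`-operator norm
(`isUnit_one_sub_of_blockLetters`).  END: the block walk expansion with derivative letters of `u ↦ (Δ_W(u) + m² + a_KP_K(U)(u))⁻¹` itself.
HONEST FRAMING: the defects `W^±` and the covariant averaging projector `P_K(U)(u)` are hypothesis families (windows as in 62); (D4)
instance 0∕1; NOT BetaPertH, NOT continuum, NOT Clay.
-/
import Summits.QuantumFields.BalabanUV.Gaps.D4WalkBlockCovariantAveraging
import Summits.QuantumFields.BalabanUV.Gaps.D4WalkBlockLettersNeumann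

/-!
# `Gaps.D4WalkBlockCovariantPropagator` — the expansion's kernel is `(Δ_W + m² + a_KP_K(U))⁻¹`: faithfulness and invertibility
# (cell pub-balaban-gaps, seat g1-p2 gen 7)

HONEST DEPENDENCY (cell pub-balaban, verbatim): continuum YM on T⁴ ⇐ BetaPertH ∧ nine spine estimates (0/9 proved);
BetaPertH ⇐ (D1) ∧ (D4) ∧ CAP+tail.

* §1 `unshift_shift`, `Sf_transpose` (`(S_μ ⊗ 1)ᵀ = S⁻_μ ⊗ 1`), `Df_eq`, `Df_transpose_mul_Df` (`(∂_μ⊗1)ᵀ(∂_μ⊗1) = η⁻²(2 − S_μ⊗1 − S⁻_μ⊗1)`),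
  **`blockDiagonal_H`** (`(−Δ^η + m²) ⊗ 1_F = m²·1 + Δ_1 ⊗ 1`).
* §2 `norm_le_of_blockLetters`, **`isUnit_one_sub_of_blockLetters`**: block letters `Be^{−μd₁}` + cube row sum `(μ, c_μ)` + `Bc_μ < 1`
  ⟹ `1 − M` invertible (`ℓ^∞`-operator norm `< 1`).
* §3 **`covariant_kernel_eq`**: on the ball, `(G′⊗1)(1 − (V_W + V_av)(G′⊗1))⁻¹ = (Δ_W + m² + a_KP_K(U))⁻¹`.
* §4 **`blockWalkExpansion_covariantPropagator_oneScaleTorus`** — 62's END restated for the kernel `(Δ_W(u) + m² + a_KP_K(U)(u))⁻¹`.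
References: T. Bałaban, Comm. Math. Phys. **99** (1985) 389–434 [B9], (3.50)–(3.61) pp. 400–402, Cor. 3.5 p. 407; CMP **85** (1982) (2.20).
-/

noncomputable section

namespace Summit.QuantumFields.BalabanUV.Gaps.D4WalkBlockCovariantPropagator

open Metric Set Finset
open scoped Matrix NNReal
open Literature.MathematicalPhysics.QuantumFieldTheory.Balaban1983to89
open Literature.MathematicalPhysics.QuantumFieldTheory.Balaban1983to89.B9SectDWalk (DomBy)
open Literature.MathematicalPhysics.QuantumFieldTheory.Balaban1983to89.B9Thm34Ext (toB6)
open Literature.MathematicalPhysics.QuantumFieldTheory.Balaban1983to89.B9Thm37GlueTorus (torusGeom tdist1 tdist1_self tdist1_nonneg)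
open Literature.MathematicalPhysics.QuantumFieldTheory.Balaban1983to89.TreeLengthTorus (TPt)
open Literature.MathematicalPhysics.QuantumFieldTheory.Balaban1983to89.B5TorusCover (UT)
open Literature.MathematicalPhysics.QuantumFieldTheory.Balaban1983to89.B11SectG (RowSum)
open Literature.MathematicalPhysics.QuantumFieldTheory.Balaban1983to89.B5Ineq137Torus (Nv)
open Literature.MathematicalPhysics.QuantumFieldTheory.Balaban1983to89.B6Prop22OneScaleTorus (Index)
open Literature.MathematicalPhysics.QuantumFieldTheory.Balaban1983to89.B1RG242Torus (tower deriv Qk Qks G_arg)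
open Summit.QuantumFields.BalabanUV.Gaps.D4WalkBlock
  (rowMass blockNorm blockNorm_nonneg rowMass_le_blockNorm BlockWalkExpansion)
open Summit.QuantumFields.BalabanUV.Gaps.D4WalkBlockDerivative (perturb_kernel_eq_inv blockWalkExpansion_perturb_of_derivLetters)
open Summit.QuantumFields.BalabanUV.Gaps.D4WalkBlockFlatLetters (cubeOf blockWalkExpansion_const)
open Summit.QuantumFields.BalabanUV.Gaps.D4WalkBlockFlatFibre (flatLettersFibre_oneScaleTorus)
open Summit.QuantumFields.BalabanUV.Gaps.D4WalkBlockCovariantGeometry (SBf shift_unshift blockNorm_SBf_mul_le)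
open Summit.QuantumFields.BalabanUV.Gaps.D4WalkBlockCovariantShift
  (Df Sf covDop covB covShift covLap flatLap Sf_eq SBf_mul_Sf flatLap_sub_covLap)
open Summit.QuantumFields.BalabanUV.Gaps.D4WalkBlockCovariantAveraging (covShiftAv_dominated covShiftAv_holo)
open Summit.QuantumFields.BalabanUV.Gaps.D4WalkBlockLettersNeumann (norm_le_of_blockLetters isUnit_one_sub_of_blockLetters)

/-! ## §1. The tower's `H = −Δ^η + m²` fibres to `m²·1 + Δ_1 ⊗ 1` -/

section FlatLap
variable (P : Params) (F : Type) [Fintype F] [DecidableEq F]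

/-- `(x + e_μ) − e_μ = x`. -/
theorem unshift_shift (x : Site P 0) (μ : Fin P.d) : Site.unshift (Site.shift x μ) μ = x := by
  unfold Site.shift Site.unshift
  funext i
  by_cases h : i = μ
  · subst h; simp
  · simp [Function.update_of_ne h]

omit [Fintype F] in
/-- `(S_μ ⊗ 1)ᵀ = S⁻_μ ⊗ 1` (the shift is a permutation). -/
theorem Sf_transpose (μ : Fin P.d) : (Sf P F μ)ᵀ = SBf P F μ := by
  ext p q
  simp only [Matrix.transpose_apply, Sf, SBf, Matrix.of_apply]
  by_cases h : q = (Site.unshift p.1 μ, p.2)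
  · have h' : p = (Site.shift q.1 μ, q.2) := by
      rw [h]; exact Prod.ext (shift_unshift p.1 μ).symm rfl
    rw [if_pos h', if_pos h]
  · have h' : ¬ p = (Site.shift q.1 μ, q.2) := fun h' =>
      h (by rw [h']; exact Prod.ext (unshift_shift P q.1 μ).symm rfl)
    rw [if_neg h', if_neg h]

omit [Fintype F] in
/-- `∂_μ ⊗ 1 = η⁻¹(S_μ ⊗ 1 − 1)`. -/
theorem Df_eq (μ : Fin P.d) : Df P F μ = (P.eps⁻¹ : ℂ) • (Sf P F μ - 1) := by
  have hε : (P.eps : ℂ) ≠ 0 := by exact_mod_cast P.eps_pos.ne'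
  rw [Sf_eq, add_sub_cancel_left, smul_smul, inv_mul_cancel₀ hε, one_smul]

/-- `(∂_μ ⊗ 1)ᵀ(∂_μ ⊗ 1) = η⁻²(2·1 − S_μ ⊗ 1 − S⁻_μ ⊗ 1)` (`S⁻S = 1`). -/
theorem Df_transpose_mul_Df (μ : Fin P.d) :
    (Df P F μ)ᵀ * Df P F μ = ((P.eps⁻¹ : ℂ) ^ 2) • ((2 : ℂ) • (1 : Matrix (Site P 0 × F) (Site P 0 × F) ℂ) - Sf P F μ - SBf P F μ) := by
  have hT : (Df P F μ)ᵀ = (P.eps⁻¹ : ℂ) • (SBf P F μ - 1) := by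
    rw [Df_eq, Matrix.transpose_smul, Matrix.transpose_sub, Matrix.transpose_one, Sf_transpose]
  rw [hT, Df_eq, Matrix.smul_mul, Matrix.mul_smul, smul_smul, ← pow_two]
  congr 1
  rw [Matrix.sub_mul, Matrix.mul_sub, Matrix.mul_sub, Matrix.one_mul, Matrix.mul_one, Matrix.one_mul, SBf_mul_Sf, two_smul]
  abel

/-- `(m²·1).map ofReal = m²·1`. -/
theorem map_smul_one (msq : ℝ) :
    (msq • (1 : Matrix (Site P 0) (Site P 0) ℝ)).map ((↑) : ℝ → ℂ) = (msq : ℂ) • (1 : Matrix (Site P 0) (Site P 0) ℂ) := by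
  ext x y
  simp only [Matrix.map_apply, Matrix.smul_apply, Matrix.one_apply, smul_eq_mul]
  split_ifs <;> simp

/-- **`(−Δ^η + m²) ⊗ 1_F = m²·1 + Δ_1 ⊗ 1`**: the tower's `H = m²·1 + Σ_μ(∂_μ)ᵀ∂_μ` (B1 (1.11)), fibred, is the flat fibred Laplacian
of `D4WalkBlockCovariantShift` plus the mass. [cite: Balaban1985BackgroundPropagators, (3.23) p.394] -/
theorem blockDiagonal_H (msq : ℝ) :
    Matrix.blockDiagonal (fun _ : F => (B1RG242Torus.H P msq).map ((↑) : ℝ → ℂ)) =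
      (msq : ℂ) • (1 : Matrix (Site P 0 × F) (Site P 0 × F) ℂ) + flatLap P F := by
  let ψ : Matrix (Site P 0) (Site P 0) ℝ →+* Matrix (Site P 0 × F) (Site P 0 × F) ℂ :=
    (Matrix.blockDiagonalRingHom (Site P 0) F ℂ).comp
      ((Pi.constRingHom F (Matrix (Site P 0) (Site P 0) ℂ)).comp (Complex.ofRealHom.mapMatrix))
  have hψ : ∀ M : Matrix (Site P 0) (Site P 0) ℝ, ψ M = Matrix.blockDiagonal (fun _ : F => M.map ((↑) : ℝ → ℂ)) := fun M => rfl
  have hψT : ∀ M : Matrix (Site P 0) (Site P 0) ℝ, ψ Mᵀ = (ψ M)ᵀ := fun M => by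
    rw [hψ, hψ, Matrix.blockDiagonal_transpose]
    simp only [Matrix.transpose_map]
  have hψD : ∀ μ, ψ (deriv P 0 P.eps μ) = Df P F μ := fun μ => rfl
  have hψ1 : ψ (msq • 1) = (msq : ℂ) • 1 := by
    rw [hψ, map_smul_one]
    show Matrix.blockDiagonal ((msq : ℂ) • (1 : F → Matrix (Site P 0) (Site P 0) ℂ)) = _
    rw [Matrix.blockDiagonal_smul, Matrix.blockDiagonal_one]
  rw [← hψ, show B1RG242Torus.H P msq = msq • 1 + ∑ μ, (deriv P 0 P.eps μ)ᵀ * deriv P 0 P.eps μ from rfl, map_add, map_sum,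
    hψ1]
  congr 1
  rw [flatLap, Finset.smul_sum]
  refine Finset.sum_congr rfl fun μ _ => ?_
  rw [map_mul, hψT, hψD, Df_transpose_mul_Df]

end FlatLap

/-! ## §2. Invertibility of `1 − M` from block letters: `D4WalkBlockLettersNeumann` (shared with the multi-level chain) -/

/-! ## §3. Faithfulness: the kernel is `(Δ_W + m² + a_KP_K(U))⁻¹` -/

section Faithful
variable (P : Params) (F : Type) [Fintype F] [DecidableEq F]
variable {E : Type*} [NormedAddCommGroup E] [NormedSpace ℂ E]
variable (Wp Wm : Fin P.d → E → Site P 0 → Matrix F F ℂ) (PU : E → Matrix (Site P 0 × F) (Site P 0 × F) ℂ) (a msq : ℝ)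

/-- The flat block-averaging term `P_K ⊗ 1_F = (Q*_KQ_K) ⊗ 1`. -/
def Pf : Matrix (Site P 0 × F) (Site P 0 × F) ℂ :=
  Matrix.blockDiagonal fun _ : F => (Qks P P.K * Qk P P.K).map ((↑) : ℝ → ℂ)

/-- The averaging correction `V_av(u) = a_K(P_K ⊗ 1 − P_K(U)(u))` (`a_K = α P a K`, `= a_K·(L^Kη)⁻² = a_K` at `L^Kη = 1`). -/
def Vav (u : E) : Matrix (Site P 0 × F) (Site P 0 × F) ℂ :=
  (B1RG242Torus.α P a P.K : ℂ) • (Pf P F - PU u)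

/-- The one-scale COVARIANT operator `Δ_W(u) + m²·1 + a_KP_K(U)(u)`. [cite: Balaban1985BackgroundPropagators, (3.8) p.392, (3.50) p.400] -/
def covOp (u : E) : Matrix (Site P 0 × F) (Site P 0 × F) ℂ :=
  covLap P F Wp Wm u + (msq : ℂ) • 1 + (B1RG242Torus.α P a P.K : ℂ) • PU u

/-- The fibred flat propagator `G′_K ⊗ 1_F`. -/
def Gf : Matrix (Site P 0 × F) (Site P 0 × F) ℂ :=
  Matrix.blockDiagonal fun _ : F => ((tower P a msq).G P.K).map ((↑) : ℝ → ℂ)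

/-- `((H + a_KP_K) ⊗ 1)·(G′_K ⊗ 1) = 1` for `K ≥ 1`, `a > 0`, `m² ≥ 0` (the tree's `G_arg`). -/
theorem flatOp_mul_Gf (ha : 0 < a) (hmsq : 0 ≤ msq) (hK : 1 ≤ P.K) :
    ((msq : ℂ) • 1 + flatLap P F + (B1RG242Torus.α P a P.K : ℂ) • Pf P F) * Gf P F a msq = 1 := by
  have hG := B1RG242.StepData.Gk_mul ((tower P a msq).step P.K) (G_arg P ha hmsq P.K hK)
  let ψ : Matrix (Site P 0) (Site P 0) ℝ →+* Matrix (Site P 0 × F) (Site P 0 × F) ℂ :=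
    (Matrix.blockDiagonalRingHom (Site P 0) F ℂ).comp
      ((Pi.constRingHom F (Matrix (Site P 0) (Site P 0) ℂ)).comp (Complex.ofRealHom.mapMatrix))
  have hψ : ∀ M : Matrix (Site P 0) (Site P 0) ℝ, ψ M = Matrix.blockDiagonal (fun _ : F => M.map ((↑) : ℝ → ℂ)) := fun M => rfl
  have h1 := congrArg ψ hG
  rw [map_mul, map_one, map_add] at h1
  have hsm : ψ (((tower P a msq).step P.K).α • ((tower P a msq).step P.K).Pk) = (B1RG242Torus.α P a P.K : ℂ) • Pf P F := by
    show ψ (B1RG242Torus.α P a P.K • (Qks P P.K * Qk P P.K)) = _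
    have e : (B1RG242Torus.α P a P.K • (Qks P P.K * Qk P P.K)).map ((↑) : ℝ → ℂ) =
        (B1RG242Torus.α P a P.K : ℂ) • (Qks P P.K * Qk P P.K).map ((↑) : ℝ → ℂ) := by
      ext x y; simp
    rw [hψ, e, Pf]
    show Matrix.blockDiagonal ((B1RG242Torus.α P a P.K : ℂ) • fun _ : F => (Qks P P.K * Qk P P.K).map ((↑) : ℝ → ℂ)) = _
    rw [Matrix.blockDiagonal_smul]
  rw [hsm, show ψ ((tower P a msq).step P.K).H = Matrix.blockDiagonal (fun _ : F => (B1RG242Torus.H P msq).map ((↑) : ℝ → ℂ))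
    from rfl, blockDiagonal_H] at h1
  exact h1

omit [NormedAddCommGroup E] [NormedSpace ℂ E] in
/-- `(H + a_KP_K) ⊗ 1 − (V_W + V_av) = Δ_W + m² + a_KP_K(U)`. -/
theorem flatOp_sub_perturb (u : E) :
    ((msq : ℂ) • 1 + flatLap P F + (B1RG242Torus.α P a P.K : ℂ) • Pf P F) - (covShift P F Wp Wm u + Vav P F PU a u) =
      covOp P F Wp Wm PU a msq u := by
  rw [← flatLap_sub_covLap, covOp, Vav, smul_sub]
  abel

omit [NormedAddCommGroup E] [NormedSpace ℂ E] in
/-- **FAITHFULNESS.**  Wherever `1 − (V_W + V_av)(G′⊗1)` is invertible, the expansion's kernel `(G′⊗1)(1 − (V_W + V_av)(G′⊗1))⁻¹` IS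
`(Δ_W + m² + a_KP_K(U))⁻¹` — `G′(U′U) = G′(U)(I − V′(A)G′(U))⁻¹` of (3.64) read backwards. [cite: Balaban1985BackgroundPropagators, (3.60)–(3.64) p.402] -/
theorem covariant_kernel_eq (ha : 0 < a) (hmsq : 0 ≤ msq) (hK : 1 ≤ P.K) (u : E)
    (hunit : IsUnit (1 - (covShift P F Wp Wm u + Vav P F PU a u) * Gf P F a msq).det) :
    Gf P F a msq * (1 - (covShift P F Wp Wm u + Vav P F PU a u) * Gf P F a msq)⁻¹ = (covOp P F Wp Wm PU a msq u)⁻¹ := by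
  rw [← flatOp_sub_perturb]
  exact perturb_kernel_eq_inv _ _ _ (flatOp_mul_Gf P F a msq ha hmsq hK) hunit

end Faithful

/-! ## §4. The block walk expansion of `(Δ_W + m² + a_KP_K(U))⁻¹` on the one-scale torus family -/

section Step
variable {d L : ℕ} {a msq : ℝ}
variable {dd N' : ℕ} {E : Type*} [NormedAddCommGroup E] [NormedSpace ℂ E]

/-- **[B9] COR. 3.5 ON THE ONE-SCALE TORUS FAMILY FOR THE COVARIANT PROPAGATOR ITSELF.**  There are `δ₀, C > 0` (B6's) such that for
every member `i`, every finite fibre `F`, every holomorphic family of transport defects `W^±` with the bond window `ηα` and the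
divergence window `η²α′`, every holomorphic covariant averaging projector `P_K(U)(u)` whose correction `V_av = a_K(P_K⊗1 − P_K(U))` is
cube-local with row sums at most `α_av` on the ball, every cube row sum `(μ, c_μ)`, rates `0 ≤ μ`, `2μ ≤ ε`, `2μ ≤ ½δ₀ − ε − μ` and the
margin of 62: `u ↦ (Δ_W(u) + m² + a_KP_K(U)(u))⁻¹` — the one-scale covariant propagator `G′_K(U)` ⊗ fibre — IS a block walk expansion at
`(ε − 2μ, ½δ₀ − ε − 3μ, ·, ½δ₀ − 2μ)` with the relative derivative letters `covB δ₀` and dominating distances; NO constant depends on `K`,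
the volume or the fibre. [cite: Balaban1985BackgroundPropagators, Cor. 3.5 p.407, (3.50)–(3.64) pp.400–402; Balaban1984PropagatorsII, Prop. 2.2 (2.67) p.234] -/
theorem blockWalkExpansion_covariantPropagator_oneScaleTorus (hd : 1 ≤ d) (hL : Odd L ∧ 1 < L) (ha : 0 < a) (hmsq : 0 ≤ msq) :
    ∃ δ₀ C : ℝ, 0 < δ₀ ∧ 0 < C ∧ ∀ (i : Index d L) (F : Type) [Fintype F] [DecidableEq F] (c₀ : B13.Consts)
      (X : Finset (UT (Nv i.P i.P.K))) (R : ℝ) (Wp Wm : Fin i.P.d → E → Site i.P 0 → Matrix F F ℂ)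
      (PU : E → Matrix (Site i.P 0 × F) (Site i.P 0 × F) ℂ) (α α' αav ε μ cμ : ℝ),
      (∀ ν x a' b, DifferentiableOn ℂ (fun u => Wp ν u x a' b) (ball (0 : E) R)) →
      (∀ ν x a' b, DifferentiableOn ℂ (fun u => Wm ν u x a' b) (ball (0 : E) R)) →
      (∀ p q, DifferentiableOn ℂ (fun u => PU u p q) (ball (0 : E) R)) →
      0 ≤ α → 0 ≤ α' → 0 ≤ αav →
      (∀ ν, ∀ u ∈ ball (0 : E) R, ∀ x a', ∑ b, ‖Wp ν u x a' b‖ ≤ i.P.eps * α) →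
      (∀ ν, ∀ u ∈ ball (0 : E) R, ∀ x a', ∑ b, ‖Wm ν u x a' b‖ ≤ i.P.eps * α) →
      (∀ u ∈ ball (0 : E) R, ∀ x a', ∑ b, ‖(∑ ν, (Wp ν u x + Wm ν u x)) a' b‖ ≤ i.P.eps ^ 2 * α') →
      (∀ u p q, Vav i.P F PU a u p q ≠ 0 → cubeOf i.P p.1 = cubeOf i.P q.1) →
      (∀ u ∈ ball (0 : E) R, ∀ p, ∑ q, ‖Vav i.P F PU a u p q‖ ≤ αav) →
      0 ≤ μ → 2 * μ ≤ ε → 2 * μ ≤ δ₀ / 2 - ε - μ → 0 ≤ cμ →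
      RowSum (toB6 (torusGeom (Nv i.P i.P.K) 0 0 0) 0 True) μ cμ →
      cμ * (cμ * 1 * (1 * ((α' + αav + ∑ ι, α * covB i.P δ₀ ι) * C)) * cμ) * cμ < 1 →
      ∃ (W : Type) (T : W → (TPt dd N' → ℂ) → E → Matrix (Site i.P 0 × F) (Site i.P 0 × F) ℂ) (SX' : Set W) (A' : W → ℝ)
        (D' : W → UT (Nv i.P i.P.K) → UT (Nv i.P i.P.K) → ℝ),
        BlockWalkExpansion c₀ (fun q : Site i.P 0 × F => cubeOf i.P q.1) (fun q : Site i.P 0 × F => cubeOf i.P q.1)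
          (fun (_ : TPt dd N' → ℂ) u => (covOp i.P F Wp Wm PU a msq u)⁻¹) X R
          (ε - 2 * μ) (δ₀ / 2 - ε - μ - 2 * μ)
          (cμ * C * (1 * (1 - cμ * (cμ * 1 * (1 * ((α' + αav + ∑ ι, α * covB i.P δ₀ ι) * C)) * cμ) * cμ)⁻¹) * cμ)
          T SX' A' D' (δ₀ / 2 - 2 * μ) ∧
        (∀ (ι : Fin i.P.d ⊕ Fin i.P.d) ω (σ : TPt dd N' → ℂ), (∀ j, ‖σ j‖ ≤ Real.exp c₀.κ₁) → ∀ u ∈ ball (0 : E) R, ∀ Y Y',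
          blockNorm (fun q : Site i.P 0 × F => cubeOf i.P q.1) (fun q : Site i.P 0 × F => cubeOf i.P q.1)
              (covDop i.P F ι * T ω σ u) Y Y' ≤
            covB i.P δ₀ ι * (A' ω * Real.exp (-((δ₀ / 2 - 2 * μ) * D' ω Y Y')))) ∧
        ∀ ω, DomBy (toB6 (torusGeom (Nv i.P i.P.K) 0 0 0) 0 True) (D' ω) := by
  obtain ⟨δ₀, C, hδ₀, hC, hflat⟩ := flatLettersFibre_oneScaleTorus d L hd hL ha hmsq
  refine ⟨δ₀, C, hδ₀, hC, fun i F _ _ c₀ X R Wp Wm PU α α' αav ε μ cμ hWph hWmh hPUh hα hα' hαav hWp hWm hdiv hloc hav hμ hμε hμκ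
    hcμ hrow hq => ?_⟩
  -- the flat fibred propagator as a one-term expansion (as in 62)
  have hGf : ∀ Y Y', blockNorm (fun q : Site i.P 0 × F => cubeOf i.P q.1) (fun q : Site i.P 0 × F => cubeOf i.P q.1)
      (Gf i.P F a msq) Y Y' ≤ C * Real.exp (-(δ₀ / 2 * tdist1 (Nv i.P i.P.K) Y Y')) := fun Y Y' => (hflat i F Y Y').1
  have hW := blockWalkExpansion_const (dd := dd) (N' := N') (E := E) c₀ (fun q : Site i.P 0 × F => cubeOf i.P q.1) X
    (Gf i.P F a msq) R (ε := ε) (κ := δ₀ / 2 - ε - μ) (ρ := δ₀ / 2) hC.le (by linarith) hGf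
  have hD0 : ∀ (ι : Fin i.P.d ⊕ Fin i.P.d) (Y Y' : UT (Nv i.P i.P.K)),
      blockNorm (fun q : Site i.P 0 × F => cubeOf i.P q.1) (fun q : Site i.P 0 × F => cubeOf i.P q.1)
          (covDop i.P F ι * Gf i.P F a msq) Y Y' ≤ covB i.P δ₀ ι * (C * Real.exp (-(δ₀ / 2 * tdist1 (Nv i.P i.P.K) Y Y'))) := by
    intro ι Y Y'
    cases ι with
    | inl ν =>
        show blockNorm _ _ (Df i.P F ν * Gf i.P F a msq) Y Y' ≤ 1 * _
        rw [one_mul]; exact (hflat i F Y Y').2 ν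
    | inr ν =>
        show blockNorm _ _ (SBf i.P F ν * Df i.P F ν * Gf i.P F a msq) Y Y' ≤ Real.exp (δ₀ / 2) * _
        rw [Matrix.mul_assoc]
        have h := blockNorm_SBf_mul_le ν (Df i.P F ν * Gf i.P F a msq) hC.le (by linarith : (0 : ℝ) ≤ δ₀ / 2)
          (fun Y Y' => (hflat i F Y Y').2 ν) Y Y'
        calc _ ≤ _ := h
          _ = _ := by ring
  have hBι : ∀ ι, 0 ≤ covB i.P δ₀ ι := fun ι => by cases ι <;> simp only [covB] <;> positivity
  have hVavh : ∀ p q, DifferentiableOn ℂ (fun u => Vav i.P F PU a u p q) (ball (0 : E) R) := fun p q => by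
    simp only [Vav, Matrix.smul_apply, Matrix.sub_apply, smul_eq_mul]
    exact (differentiableOn_const _).mul ((differentiableOn_const _).sub (hPUh p q))
  have hdom := covShiftAv_dominated i.P F Wp Wm (Vav i.P F PU a) (fun x => cubeOf i.P x) hα hα' hαav hWp hWm hdiv hloc hav
  obtain ⟨W, T, SX', A', D', hE, hlet, hDom⟩ := blockWalkExpansion_perturb_of_derivLetters (Dop := covDop i.P F)
    (B := covB i.P δ₀) (V := fun u => covShift i.P F Wp Wm u + Vav i.P F PU a u) hW (fun _ Y Y' => le_rfl) hBι
    (fun ι _ σ _ u _ Y Y' => hD0 ι Y Y') (covShiftAv_holo i.P F Wp Wm (Vav i.P F PU a) hWph hWmh hVavh) (add_nonneg hα' hαav)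
    (fun _ => hα) hdom hμ hμε hμκ (by linarith) hC.le hcμ hrow hq
  refine ⟨W, T, SX', A', D', hE.congrK (fun σ u _ hu => ?_), hlet, hDom⟩
  -- invertibility of `1 − V(u)(G′⊗1)` on the ball from the letters, the row sum and the margin
  set B := (α' + αav + ∑ ι, α * covB i.P δ₀ ι) * C with hB
  have hB0 : 0 ≤ B := by
    have : 0 ≤ ∑ ι, α * covB i.P δ₀ ι := Finset.sum_nonneg fun ι _ => mul_nonneg hα (hBι ι)
    positivity
  have hlettersV : ∀ Y Y', blockNorm (fun q : Site i.P 0 × F => cubeOf i.P q.1) (fun q : Site i.P 0 × F => cubeOf i.P q.1)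
      ((covShift i.P F Wp Wm u + Vav i.P F PU a u) * Gf i.P F a msq) Y Y' ≤ B * Real.exp (-(μ * tdist1 (Nv i.P i.P.K) Y Y')) := by
    intro Y Y'
    have hd0 := tdist1_nonneg (N := Nv i.P i.P.K) Y Y'
    have hexp : Real.exp (-(δ₀ / 2 * tdist1 (Nv i.P i.P.K) Y Y')) ≤ Real.exp (-(μ * tdist1 (Nv i.P i.P.K) Y Y')) :=
      Real.exp_le_exp.2 (by nlinarith)
    calc _ ≤ (α' + αav) * blockNorm (fun q : Site i.P 0 × F => cubeOf i.P q.1) (fun q : Site i.P 0 × F => cubeOf i.P q.1)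
              (Gf i.P F a msq) Y Y' + ∑ ι, α * blockNorm (fun q : Site i.P 0 × F => cubeOf i.P q.1)
              (fun q : Site i.P 0 × F => cubeOf i.P q.1) (covDop i.P F ι * Gf i.P F a msq) Y Y' := hdom u hu _ Y Y'
      _ ≤ (α' + αav) * (C * Real.exp (-(δ₀ / 2 * tdist1 (Nv i.P i.P.K) Y Y'))) +
            ∑ ι, α * (covB i.P δ₀ ι * (C * Real.exp (-(δ₀ / 2 * tdist1 (Nv i.P i.P.K) Y Y')))) :=
          add_le_add (mul_le_mul_of_nonneg_left (hGf Y Y') (add_nonneg hα' hαav))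
            (Finset.sum_le_sum fun ι _ => mul_le_mul_of_nonneg_left (hD0 ι Y Y') hα)
      _ = B * Real.exp (-(δ₀ / 2 * tdist1 (Nv i.P i.P.K) Y Y')) := by
          have hs : ∑ ι, α * (covB i.P δ₀ ι * (C * Real.exp (-(δ₀ / 2 * tdist1 (Nv i.P i.P.K) Y Y')))) =
              (∑ ι, α * covB i.P δ₀ ι) * (C * Real.exp (-(δ₀ / 2 * tdist1 (Nv i.P i.P.K) Y Y'))) := by
            rw [Finset.sum_mul]; exact Finset.sum_congr rfl fun ι _ => by ring
          rw [hs, hB]; ring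
      _ ≤ B * Real.exp (-(μ * tdist1 (Nv i.P i.P.K) Y Y')) := mul_le_mul_of_nonneg_left hexp hB0
  have hunit : IsUnit (1 - (covShift i.P F Wp Wm u + Vav i.P F PU a u) * Gf i.P F a msq).det := by
    cases isEmpty_or_nonempty (Site i.P 0 × F) with
    | inl hE0 => rw [Matrix.det_isEmpty]; exact isUnit_one
    | inr hne =>
        obtain ⟨p0⟩ := hne
        have hcμ1 : 1 ≤ cμ := by
          have h : ∑ y' : UT (Nv i.P i.P.K), Real.exp (-(μ * tdist1 (Nv i.P i.P.K) (cubeOf i.P p0.1) y')) ≤ cμ :=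
            hrow (cubeOf i.P p0.1)
          refine le_trans (le_trans (le_of_eq ?_) (Finset.single_le_sum (f := fun y' : UT (Nv i.P i.P.K) =>
            Real.exp (-(μ * tdist1 (Nv i.P i.P.K) (cubeOf i.P p0.1) y'))) (fun y' _ => (Real.exp_pos _).le)
            (Finset.mem_univ (cubeOf i.P p0.1)))) h
          rw [tdist1_self, mul_zero, neg_zero, Real.exp_zero]
        have hqB : B * cμ < 1 := by
          have e : cμ * (cμ * 1 * (1 * ((α' + αav + ∑ ι, α * covB i.P δ₀ ι) * C)) * cμ) * cμ = B * cμ * cμ ^ 3 := by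
            rw [hB]; ring
          rw [e] at hq
          have h1 : B * cμ * 1 ≤ B * cμ * cμ ^ 3 := mul_le_mul_of_nonneg_left (one_le_pow₀ hcμ1) (mul_nonneg hB0 hcμ)
          linarith
        exact isUnit_one_sub_of_blockLetters (fun q : Site i.P 0 × F => cubeOf i.P q.1) _ hB0 hcμ hlettersV hrow hqB
  exact (covariant_kernel_eq i.P F Wp Wm PU a msq ha hmsq i.hK u hunit).symm

end Step

/-! ## §5. (v2.1) The kernel is a two-sided inverse: `(Δ_W + m² + a_KP_K(U))·G′(U) = 1 = G′(U)·(Δ_W + m² + a_KP_K(U))` -/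

section Inverse
variable (P : Params) (F : Type) [Fintype F] [DecidableEq F] {E : Type*}
variable (Wp Wm : Fin P.d → E → Site P 0 → Matrix F F ℂ) (PU : E → Matrix (Site P 0 × F) (Site P 0 × F) ℂ) (a msq : ℝ)

/-- Wherever `1 − (V_W + V_av)(G′⊗1)` is invertible, the covariant operator times the expansion's kernel is `1`:
`(Δ_W(u) + m² + a_KP_K(U)(u))·[(G′⊗1)(1 − (V_W + V_av)(G′⊗1))⁻¹] = 1` ((3.62): `(Δ − V)·W(1 − VW)⁻¹ = (1 − VW)(1 − VW)⁻¹`).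
[cite: Balaban1985BackgroundPropagators, (3.60)–(3.64) p.402] -/
theorem covOp_mul_kernel (ha : 0 < a) (hmsq : 0 ≤ msq) (hK : 1 ≤ P.K) (u : E)
    (hunit : IsUnit (1 - (covShift P F Wp Wm u + Vav P F PU a u) * Gf P F a msq).det) :
    covOp P F Wp Wm PU a msq u * (Gf P F a msq * (1 - (covShift P F Wp Wm u + Vav P F PU a u) * Gf P F a msq)⁻¹) = 1 := by
  rw [← flatOp_sub_perturb, ← Matrix.mul_assoc, Matrix.sub_mul, flatOp_mul_Gf P F a msq ha hmsq hK]
  exact Matrix.mul_nonsing_inv _ hunit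

/-- Hence the one-scale covariant operator `Δ_W(u) + m² + a_KP_K(U)(u)` is invertible there (its determinant is a unit). -/
theorem isUnit_det_covOp (ha : 0 < a) (hmsq : 0 ≤ msq) (hK : 1 ≤ P.K) (u : E)
    (hunit : IsUnit (1 - (covShift P F Wp Wm u + Vav P F PU a u) * Gf P F a msq).det) :
    IsUnit (covOp P F Wp Wm PU a msq u).det :=
  Matrix.isUnit_det_of_right_inverse (covOp_mul_kernel P F Wp Wm PU a msq ha hmsq hK u hunit)

/-- and the kernel is also a LEFT inverse: `[(G′⊗1)(1 − (V_W + V_av)(G′⊗1))⁻¹]·(Δ_W(u) + m² + a_KP_K(U)(u)) = 1`. -/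
theorem kernel_mul_covOp (ha : 0 < a) (hmsq : 0 ≤ msq) (hK : 1 ≤ P.K) (u : E)
    (hunit : IsUnit (1 - (covShift P F Wp Wm u + Vav P F PU a u) * Gf P F a msq).det) :
    Gf P F a msq * (1 - (covShift P F Wp Wm u + Vav P F PU a u) * Gf P F a msq)⁻¹ * covOp P F Wp Wm PU a msq u = 1 :=
  mul_eq_one_comm.mp (covOp_mul_kernel P F Wp Wm PU a msq ha hmsq hK u hunit)

end Inverse

end Summit.QuantumFields.BalabanUV.Gaps.D4WalkBlockCovariantPropagator

end
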